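import Summits.BirchSwinnertonDyer.Rank1Residual.P2.PrintCf2SplitBadTwoDeltaRead
import Literature.NumberTheory.GaloisRepresentations.LubinTateComparisonTorsionPacketTwo
import HarnessLib

set_option autoImplicit false

/-!
# R219-INST₂-CORE (γ′) ⊕ (δ) CLOSED IN KERNEL on every PRIMITIVE reflecting torsion family: `PacketMatching` PROVED
# (the comparison `ϑ` carries the primitive `2^{n+1}`-torsion packet of `Ĝ_m` onto the `Gal(E·F_{π'}^{n+1}/E)`-orbit of
# the coherent division point), hence `ValueIdentification`, `SeamModLevel` and ★★★ `delta_read₂` with NO typed input left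

Cell `bsd-print-cf2`, discharge-interface typer `bsd-print-cf2-ty2` g46 (literature-prover seat; Summits-side helpers in the
typer's directory `Rank1Residual/P2/`, Theses-free, no item).  Sequel of the port P62 (`PrintCf2SplitBadTwoDeltaRead.lean`, STUB-PLAN
`stub_heegnerIndexLowerAtTwo` v8.1 row 132 = R227, crux `PrintCf2.SplitBadTwoLowerHalfOfFacts`, stmt-BirchSwinnertonDyer-27851): the
stub-critic graded the junction (γ′) of R219-INST₂-CORE as `PacketMatching` [typed, XS–S, "tree-assemblable"] ⊕ `LocalUntwistExists`
[the tree's theorem `LocalUntwist.localUntwistExists`].  With the Literature theorem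
`Literature.NumberTheory.GaloisRepresentations.exists_unit_coe_compSeriesC_eq_mapPt_cohPt` (`LubinTateComparisonTorsionPacketTwo.lean`:
for `1 + t` a primitive `2^{n+1}`-th root of unity, `ϑ(t) = σ_w(ι ω_{n+1})` for a unit `w`) the typed node `PacketMatching` is
PROVED for every family `z` whose unit-indexed members are primitive (`(1 + z_γ)^{2^{n+1}} = 1`, `(1 + z_γ)^{2^n} ≠ 1`) — in
particular for the reflecting family `z_a = ζ^a − 1` of a `ζ` with `ζ^{2^n} = −1` (`exists_isReflectingFamily_primitive`).  HONEST
FRAMING: road-B′ construction plumbing below the receptacle (weight 0 in the critic's Heegner-weight test); nothing here proves BSD,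
the crux, the stub or HARDEST (a)/(b); no `def`, no named fact, no `sorry`.

* ★★ `exists_packetMatching` — primitive family ⟹ `∃ v, PacketMatching … n z v`.
* `exists_isReflectingFamily_primitive` — a `ζ ∈ ℂ_F` with `ζ^{2^n} = −1` gives a reflecting AND primitive family.
* ★ `exists_valueIdentification` (E3 discharged), ★ `exists_seamModLevel_untwistedLogTable` (E1 discharged for the untwisted log
  table of the Galois conjugates `τ_γ(β_n)`, `τ_γ|_{𝒪_E} = φ^{n+1}`).
* ★★★ `exists_delta_read₂_untwisted` — for `1 ≤ n`, every relative norm-coherent unit `β` and every primitive reflecting family: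
  P47's `RamifiedReading` (`Γ = (ℤ/2^{n+1})ˣ`, `e = refl`, `s = 2^n`, `γ₀ = 1 + 2^n`, `κ = ½`, `V₂ = −c_β`) holds for the reading
  witness's values with the unit table `½·(T γ − T(γγ₀))`, `T = plog(c·θ ι(τ_γ β_n))` — the junction (γ′) ⊕ (δ) of R219-INST₂-CORE
  with no hypothesis beyond the frame binders; `exists_delta_charSum_untwisted` — the consumer's character sum.

References: stub-critic `CRITIC-ROWS-g46.md` row 132 (R227); [deShalit1987] I.3.2 (5) (p. 17), I §1.8, I §2.2; [LubinTate1965] Lemma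
p. 385 (18); [CasselsFrohlichANT1967] Ch. VI §3.6 Prop. 6.
-/

noncomputable section

open scoped PowerSeries.WithPiTopology

namespace Summit.BirchSwinnertonDyer.Rank1Residual.P2.DeltaRead

section PacketMatchingProved

open ValuativeRel IsLocalRing Field
open Literature.NumberTheory.Transcendental
open Literature.NumberTheory.GaloisRepresentations Literature.NumberTheory.GaloisRepresentations.IsNonarchimedeanLocalField
  Literature.NumberTheory.GaloisRepresentations.LubinTate Literature.NumberTheory.PAdicHodge
  Literature.NumberTheory.EllipticCurves
open InstTwoCore (thetaBar constantCoeff_thetaBar reflQuotC reflQuotN gaugeUnit gaugeConst)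
open SeamModLevel
open LocalUntwist (ActsAsFrobPow)

variable {F : Type} [Field F] [ValuativeRel F] [TopologicalSpace F] [IsNonarchimedeanLocalField F]

attribute [local instance] ltNormUniformSpace ltNormIsUniformAddGroup rk1 nF nE fintypeResidueField

variable (hq : residueFieldCard F = 2) (h2 : (valuation F).IsUniformizer (((2 : ℕ) : 𝒪[F]) : F)) (u : 𝒪[F]ˣ)
variable (E : IntermediateField F (AlgebraicClosure F)) [FiniteDimensional F E] [Normal F E] [IsGalois F E]
  (hE : E ≤ maxUnramified F) {σ₀ : absoluteGaloisGroup F} (hσ₀ : IsAbsArithFrob σ₀)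
variable {ε : (maxUnramifiedCompletion F)ˣ}
  (hε : maxUnramifiedCompletion.galAut F σ₀ (ε : maxUnramifiedCompletion F) =
    algebraMap 𝒪[F] (maxUnramifiedCompletion F) (u : 𝒪[F]) * (ε : maxUnramifiedCompletion F))
variable (θ : CompletedAlgClosure F →+* ℂ_[2]) (hθc : Continuous θ)
  (hθ1 : ∀ z : CBall F, ‖θ (z : CompletedAlgClosure F)‖ ≤ 1)

omit [IsGalois F E] in
include hq in
/-- ★★ **`PacketMatching` PROVED on primitive families**: if every unit-indexed member `z_γ` of the family has `1 + z_γ` a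
primitive `2^{n+1}`-th root of unity, then `ϑ̄(z_γ) = ι(σ_{v_γ} ω_{n+1})` for some labelling `v : (ℤ/2^{n+1})ˣ → 𝒪_F^×`. -/
theorem exists_packetMatching (n : ℕ) (z : ZMod (2 ^ (n + 1)) → (maxNilIdealC F).toIdeal)
    (hz₁ : ∀ γ : (ZMod (2 ^ (n + 1)))ˣ,
      (1 + ((z (γ : ZMod (2 ^ (n + 1))) : CBall F) : CompletedAlgClosure F)) ^ 2 ^ (n + 1) = 1)
    (hz₂ : ∀ γ : (ZMod (2 ^ (n + 1)))ˣ,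
      (1 + ((z (γ : ZMod (2 ^ (n + 1))) : CBall F) : CompletedAlgClosure F)) ^ 2 ^ n ≠ 1) :
    ∃ v : (ZMod (2 ^ (n + 1)))ˣ → 𝒪[F]ˣ, PacketMatching h2 u E hE hσ₀ hε n z v := by
  choose w hw using fun γ : (ZMod (2 ^ (n + 1)))ˣ =>
    exists_unit_coe_compSeriesC_eq_mapPt_cohPt hq h2 u hσ₀ hε E hE n (z (γ : ZMod (2 ^ (n + 1)))) (hz₁ γ) (hz₂ γ)
  refine ⟨w, fun γ => ?_⟩
  rw [thetaPt_eq_evalPt₁]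
  exact hw γ

include h2 in
/-- **A root of unity `ζ ∈ ℂ_F` with `ζ^{2^n} = −1` gives a reflecting AND primitive family** `z_a = ζ^a − 1`
(`1 + z_γ = ζ^γ`, `γ` odd: `(ζ^γ)^{2^{n+1}} = 1`, `(ζ^γ)^{2^n} = (−1)^γ = −1 ≠ 1`). -/
theorem exists_isReflectingFamily_primitive (n : ℕ) {ζ : CompletedAlgClosure F} (hζ : ζ ^ 2 ^ n = -1) :
    ∃ z : ZMod (2 ^ (n + 1)) → (maxNilIdealC F).toIdeal, IsReflectingFamily n z ∧
      (∀ γ : (ZMod (2 ^ (n + 1)))ˣ,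
        (1 + ((z (γ : ZMod (2 ^ (n + 1))) : CBall F) : CompletedAlgClosure F)) ^ 2 ^ (n + 1) = 1) ∧
      (∀ γ : (ZMod (2 ^ (n + 1)))ˣ,
        (1 + ((z (γ : ZMod (2 ^ (n + 1))) : CBall F) : CompletedAlgClosure F)) ^ 2 ^ n ≠ 1) := by
  obtain ⟨z, hz, hzval⟩ := exists_isReflectingFamily h2 n hζ
  have hζ2 : ζ ^ 2 ^ (n + 1) = 1 := by rw [pow_succ, pow_mul, hζ]; norm_num
  have hodd : ∀ γ : (ZMod (2 ^ (n + 1)))ˣ, Odd (γ : ZMod (2 ^ (n + 1))).val := fun γ =>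
    Nat.coprime_two_right.mp (Nat.Coprime.coprime_dvd_right ⟨2 ^ n, by ring⟩ (ZMod.val_coe_unit_coprime γ))
  refine ⟨z, hz, fun γ => ?_, fun γ => ?_⟩
  · rw [hzval, add_sub_cancel, ← pow_mul, mul_comm, pow_mul, hζ2, one_pow]
  · rw [hzval, add_sub_cancel, ← pow_mul, mul_comm, pow_mul, hζ, (hodd γ).neg_one_pow]
    intro h
    apply two_ne_zero_C h2
    linear_combination -h

include hq in
/-- ★ **E3 discharged**: on a primitive family, VALUE IDENTIFICATION holds for untwisting automorphisms acting on `𝒪_E` as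
`φ^{n+1}` (E7 `valueIdentification_of_packetMatching` ∘ `exists_packetMatching`). -/
theorem exists_valueIdentification (n : ℕ) (β : RelNormCoherentUnits (isUniformizer_unit_mul h2 u) E)
    (z : ZMod (2 ^ (n + 1)) → (maxNilIdealC F).toIdeal)
    (hz₁ : ∀ γ : (ZMod (2 ^ (n + 1)))ˣ,
      (1 + ((z (γ : ZMod (2 ^ (n + 1))) : CBall F) : CompletedAlgClosure F)) ^ 2 ^ (n + 1) = 1)
    (hz₂ : ∀ γ : (ZMod (2 ^ (n + 1)))ˣ,
      (1 + ((z (γ : ZMod (2 ^ (n + 1))) : CBall F) : CompletedAlgClosure F)) ^ 2 ^ n ≠ 1) :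
    ∃ τ : (ZMod (2 ^ (n + 1)))ˣ →
        ((E ⊔ ltField ((u : 𝒪[F]) * ((2 : ℕ) : 𝒪[F])) n : IntermediateField F (AlgebraicClosure F)) ≃ₐ[F]
          (E ⊔ ltField ((u : 𝒪[F]) * ((2 : ℕ) : 𝒪[F])) n : IntermediateField F (AlgebraicClosure F))),
      (∀ γ, ActsAsFrobPow E σ₀ (n + 1) (τ γ)) ∧ ValueIdentification hq h2 u E hE hσ₀ hε n β z τ := by
  obtain ⟨v, hv⟩ := exists_packetMatching hq h2 u E hE hσ₀ hε n z hz₁ hz₂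
  exact valueIdentification_of_packetMatching hq h2 u E hE hσ₀ hε n β z v hv

include hq in
/-- ★ **E1 discharged**: on a primitive family, the seam-mod-level-`n` holds for the untwisted log table
`T γ = plog(c·θ ι(τ_γ β_n))` with `c = θ(ḡ_β(0)⁻¹)` (E4 ∘ E3). -/
theorem exists_seamModLevel_untwistedLogTable (n : ℕ) (hn : 1 ≤ n)
    (β : RelNormCoherentUnits (isUniformizer_unit_mul h2 u) E)
    (z : ZMod (2 ^ (n + 1)) → (maxNilIdealC F).toIdeal)
    (hz₁ : ∀ γ : (ZMod (2 ^ (n + 1)))ˣ,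
      (1 + ((z (γ : ZMod (2 ^ (n + 1))) : CBall F) : CompletedAlgClosure F)) ^ 2 ^ (n + 1) = 1)
    (hz₂ : ∀ γ : (ZMod (2 ^ (n + 1)))ˣ,
      (1 + ((z (γ : ZMod (2 ^ (n + 1))) : CBall F) : CompletedAlgClosure F)) ^ 2 ^ n ≠ 1) :
    ∃ τ : (ZMod (2 ^ (n + 1)))ˣ →
        ((E ⊔ ltField ((u : 𝒪[F]) * ((2 : ℕ) : 𝒪[F])) n : IntermediateField F (AlgebraicClosure F)) ≃ₐ[F]
          (E ⊔ ltField ((u : 𝒪[F]) * ((2 : ℕ) : 𝒪[F])) n : IntermediateField F (AlgebraicClosure F))),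
      (∀ γ, ActsAsFrobPow E σ₀ (n + 1) (τ γ)) ∧
      SeamModLevel hq h2 u E hE hσ₀ hε θ n hn β z
        (untwistedLogTable E θ n β
          (θ (((↑(baseUnit hq h2 u E hE hσ₀ β)⁻¹ : CBall F)) : CompletedAlgClosure F)) τ) := by
  obtain ⟨τ, hτ, hV⟩ := exists_valueIdentification hq h2 u E hE hσ₀ hε n β z hz₁ hz₂
  exact ⟨τ, hτ, seamModLevel_of_valueIdentification hq h2 u E hE hσ₀ hε θ n hn β z τ hV⟩

include hq hθc hθ1 in
/-- ★★★ **THE JUNCTION (γ′) ⊕ (δ) OF R219-INST₂-CORE, CLOSED IN KERNEL on every primitive reflecting torsion family.**  For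
`1 ≤ n`, every relative norm-coherent unit `β`, and every family `z : ℤ/2^{n+1} → 𝔪_ℂ` that is `Ĝ_m`-reflecting
(`1 + z_{a+2^n} = −(1 + z_a)`) with primitive unit-indexed members: there are untwisting automorphisms `τ_γ` of `E·F_{π'}^{n+1}`,
`τ_γ|_{𝒪_E} = φ^{n+1}`, such that P47's `RamifiedReading` holds for the reading witness's values `V_β ∘ z` (`V₁ = V − c_β`,
`V₂ = −c_β`, `e = refl`) with unit table `½·(T γ − T(γ·γ₀))`, `γ₀ = 1 + 2^n`, `T γ = plog(θ(ḡ_β(0)⁻¹)·θ ι(τ_γ β_n))` —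
no hypothesis beyond the frame binders. -/
theorem exists_delta_read₂_untwisted (n : ℕ) (hn : 1 ≤ n) (β : RelNormCoherentUnits (isUniformizer_unit_mul h2 u) E)
    (z : ZMod (2 ^ (n + 1)) → (maxNilIdealC F).toIdeal) (hz : IsReflectingFamily n z)
    (hz₁ : ∀ γ : (ZMod (2 ^ (n + 1)))ˣ,
      (1 + ((z (γ : ZMod (2 ^ (n + 1))) : CBall F) : CompletedAlgClosure F)) ^ 2 ^ (n + 1) = 1)
    (hz₂ : ∀ γ : (ZMod (2 ^ (n + 1)))ˣ,
      (1 + ((z (γ : ZMod (2 ^ (n + 1))) : CBall F) : CompletedAlgClosure F)) ^ 2 ^ n ≠ 1) :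
    ∃ τ : (ZMod (2 ^ (n + 1)))ˣ →
        ((E ⊔ ltField ((u : 𝒪[F]) * ((2 : ℕ) : 𝒪[F])) n : IntermediateField F (AlgebraicClosure F)) ≃ₐ[F]
          (E ⊔ ltField ((u : 𝒪[F]) * ((2 : ℕ) : 𝒪[F])) n : IntermediateField F (AlgebraicClosure F))),
      (∀ γ, ActsAsFrobPow E σ₀ (n + 1) (τ γ)) ∧
      ReadTwoCut.RamifiedReading (pow_dvd_pow 2 (Nat.le_succ n))
        (fun a => readingValue hq h2 u E hE hσ₀ hε θ β (z a))
        (fun a => readingValue hq h2 u E hE hσ₀ hε θ β (z a) + -gaugeConst hq h2 u E hE hσ₀ θ β)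
        (fun _ : ZMod (2 ^ n) => -gaugeConst hq h2 u E hE hσ₀ θ β) (Equiv.refl _)
        (fun γ => 2⁻¹ *
          (untwistedLogTable E θ n β (θ (((↑(baseUnit hq h2 u E hE hσ₀ β)⁻¹ : CBall F)) : CompletedAlgClosure F)) τ γ -
            untwistedLogTable E θ n β (θ (((↑(baseUnit hq h2 u E hE hσ₀ β)⁻¹ : CBall F)) : CompletedAlgClosure F)) τ
              (γ * shiftUnit n hn))) := by
  obtain ⟨τ, hτ, hT⟩ := exists_seamModLevel_untwistedLogTable hq h2 u E hE hσ₀ hε θ n hn β z hz₁ hz₂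
  exact ⟨τ, hτ, delta_read₂_of_seamModLevel hq h2 u E hE hσ₀ hε θ hθc hθ1 n hn β z hz _ hT⟩

include hq hθc hθ1 in
/-- ★ **What the consumer sees, unconditionally**: for every multiplicative character `ψ` of `ℤ/2^{n+1}` with
`ψ(1 + 2^n) = −1`, the `ψ`-sum of the witness's unit values (minus the gauge constant) is `Σ_γ ψ(γ)·T(γ)` for the untwisted
log table `T` of the Galois conjugates `τ_γ(β_n)`. -/
theorem exists_delta_charSum_untwisted (n : ℕ) (hn : 1 ≤ n) (β : RelNormCoherentUnits (isUniformizer_unit_mul h2 u) E)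
    (z : ZMod (2 ^ (n + 1)) → (maxNilIdealC F).toIdeal) (hz : IsReflectingFamily n z)
    (hz₁ : ∀ γ : (ZMod (2 ^ (n + 1)))ˣ,
      (1 + ((z (γ : ZMod (2 ^ (n + 1))) : CBall F) : CompletedAlgClosure F)) ^ 2 ^ (n + 1) = 1)
    (hz₂ : ∀ γ : (ZMod (2 ^ (n + 1)))ˣ,
      (1 + ((z (γ : ZMod (2 ^ (n + 1))) : CBall F) : CompletedAlgClosure F)) ^ 2 ^ n ≠ 1)
    (ψ : MulChar (ZMod (2 ^ (n + 1))) ℂ_[2]) (hψ : ψ ((shiftUnit n hn : (ZMod (2 ^ (n + 1)))ˣ) : ZMod _) = -1) :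
    ∃ τ : (ZMod (2 ^ (n + 1)))ˣ →
        ((E ⊔ ltField ((u : 𝒪[F]) * ((2 : ℕ) : 𝒪[F])) n : IntermediateField F (AlgebraicClosure F)) ≃ₐ[F]
          (E ⊔ ltField ((u : 𝒪[F]) * ((2 : ℕ) : 𝒪[F])) n : IntermediateField F (AlgebraicClosure F))),
      (∀ γ, ActsAsFrobPow E σ₀ (n + 1) (τ γ)) ∧
      ∑ γ : (ZMod (2 ^ (n + 1)))ˣ, ψ (γ : ZMod (2 ^ (n + 1))) *
          (readingValue hq h2 u E hE hσ₀ hε θ β (z γ) + -gaugeConst hq h2 u E hE hσ₀ θ β) =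
        ∑ γ : (ZMod (2 ^ (n + 1)))ˣ, ψ (γ : ZMod (2 ^ (n + 1))) *
          untwistedLogTable E θ n β (θ (((↑(baseUnit hq h2 u E hE hσ₀ β)⁻¹ : CBall F)) : CompletedAlgClosure F)) τ γ := by
  obtain ⟨τ, hτ, C, hC, hseam⟩ := exists_seamModLevel_untwistedLogTable hq h2 u E hE hσ₀ hε θ n hn β z hz₁ hz₂
  exact ⟨τ, hτ, delta_charSum hq h2 u E hE hσ₀ hε θ hθc hθ1 n hn β z hz _ C hC hseam ψ hψ⟩

end PacketMatchingProved

end Summit.BirchSwinnertonDyer.Rank1Residual.P2.DeltaRead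

end
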